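import Summits.AtomisticToContinuum.Crystallization.Theorems.OverbindingBudgetBalancedLayered
import Summits.AtomisticToContinuum.Crystallization.Theorems.ChartedPlanarOrderProfileSlavingLJLayerBalance

/-!
# OverbindingBudget — E_per beneath `BalancedLayeredClean`: stacked reduction, vanishing gap stress, basal gap rigidity (lens-4 g29, part XV)

Helper file (`--supports stmt-AtomisticToContinuum-31280`).  Slot 7 of the RDEF cone of record (ninth form,
`…OverbindingBudgetBalancedLayered.rdef_of_grossU_doorPeriodic_balanced`) is `BalancedLayeredClean Λ`: a `δ`-separated two-shell-clean
single-site-Nash virial-balanced stress-free `Layered a b w` (independent in-plane periods of norm `≤ Λ`) is uniformly clean.  Critic row 434 (3)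
asked for the pieces (1a) StackedRep · (1b′) HollowSelection · (1c) CellConvexity beneath it.  Typing them revealed a CORRECTION, recorded here
as the cut actually filed:

* **(1a) is not geometric.**  `Layered a b w` only says «two-periodic with one 2D lattice `ℤa + ℤb` and arbitrary coset offsets `w m`».  The fcc
  lattice is `Layered` along its SQUARE (001) layers (periods of norm `nn ≤ Λ`), and replacing `w m` by `w m + ε m` with an arbitrary bounded
  small `ε : ℤ → ℝ³` keeps `IsSep`, `IsClean` (tolerance `1/16`) and `Layered`, while the close-packed (111) planes of the result are only
  rank-one periodic — no height-sorted single-coset close-packed representation exists.  In-plane superstructures (sublattices of index `≤ 5`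
  have bases of norm `≤ 2`) are likewise clean and layered.  Hence the re-representation as a STACKED configuration (lens-3's `IsStacked`:
  one coset per height, common normal) carries rigidity content and must keep the analytic hypotheses: **`StackedReduction Λ Λ₁`** (§1).
  At `Λ = 2` it is a FINITE family of one-dimensional banded problems indexed by the crystallographic type of the `≤ Λ`-period plane
  (fcc `{111, 100, 110}`, hcp `{0001, 10-10, 11-20}`) × supercell index — each concluding «exactly fcc / hcp», hence basal.
* **(1b′) splits into lens-3's D1 and a virial identity.**  On a stacked representation lens-3's `NashBalance Λ₁` (⟸ `LayerForceBalance Λ₁`,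
  PROVED for every `Λ₁` as `layerForceBalance_holds`, ∧ `StraddleSummable Λ₁`, open, tail bookkeeping) gives a CONSTANT transmitted gap
  stress `σ`; **`GapStressVanishes Λ₁`** (§1) is the identity `σ = |cell| · (macroscopic stress) · n` read against `StressFree`: `σ = 0`.
* **(1c) becomes `BasalGapRigidity Λ₁`** (§1), the certificate target: every solution of `gapStress ≡ 0` on a clean separated stress-free
  stacked configuration is uniformly clean (banded contraction: the own-gap stiffness dominates the farther-gap couplings by the LJ decay
  across `≥ 2` gaps, factor `≈ (1/1.6)⁸`; in-plane shape pinned by the in-plane components of `StressFree`; saddle / top registries are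
  outside the `1/16` clean window, so Nash MINIMALITY is not needed by the certificate and is kept only as a spare hypothesis).
* Seams, PROVED (§2): `balancedStackedClean_of_pieces : NashBalance Λ₁ → GapStressVanishes Λ₁ → BasalGapRigidity Λ₁ → BalancedStackedClean Λ₁`,
  `balancedStackedClean_of_straddle` (lens-3's D1a by name: only `StraddleSummable Λ₁` is imported),
  `balancedLayeredClean_of_stacked : StackedReduction Λ Λ₁ → BalancedStackedClean Λ₁ → BalancedLayeredClean Λ`, and the cone in its
  **twelfth form** `rdef_of_grossU_doorPeriodic_basal` (§3; slot 7 ↦ `StackedReduction Λ Λ₁ ∧ StraddleSummable Λ₁ ∧ GapStressVanishes Λ₁ ∧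
  BasalGapRigidity Λ₁`; every other slot verbatim).
No `sorry`, no new axioms, no `instance` / `notation`; `[folklore]` bookkeeping only — the four pieces are the open content.
-/

noncomputable section

namespace Summit.AtomisticToContinuum.Crystallization.Theorems.OverbindingBudgetBasalGapRigidity

open Summit.AtomisticToContinuum.Crystallization.Theses.OverbindingBudget (RobustDefectLimitWindows)
open Summit.AtomisticToContinuum.Crystallization.Theses.PricedLinkCensus (ChargedEnergyGap)
open Summit.AtomisticToContinuum.Crystallization.Theorems.OverbindingBudgetGradedBareness (CleanlessExcessT)
open Summit.AtomisticToContinuum.Crystallization.Theorems.OverbindingBudgetCoherentCut (CoherentResidual)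
open Summit.AtomisticToContinuum.Crystallization.Theorems.OverbindingBudgetUniformCutStatements (GrossCleanBallsU)
open Summit.AtomisticToContinuum.Crystallization.Theorems.OverbindingBudgetElasticSplitStatements (VirialBalanced)
open Summit.AtomisticToContinuum.Crystallization.Theorems.OverbindingBudgetElasticSplitScale (CompressedVirialLaw)
open Summit.AtomisticToContinuum.Crystallization.Theorems.OverbindingBudgetElasticSplitShear (StressFree)
open Summit.AtomisticToContinuum.Crystallization.Theorems.OverbindingBudgetElasticSplitDoorBridge (CleanCharted)
open Summit.AtomisticToContinuum.Crystallization.Theorems.ChartedPlanarOrderRigidityDoor (IsClean IsNash)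
open Summit.AtomisticToContinuum.Crystallization.Theorems.ChartedPlanarOrderDensityDichotomy (μS IsSep)
open Summit.AtomisticToContinuum.Crystallization.Theorems.ChartedPlanarOrderDoorLayered (Layered DoorPeriodic)
open Summit.AtomisticToContinuum.Crystallization.Theorems.ChartedPlanarOrderProfileSlavingLJ (IsStacked gapStress incr NashBalance)
open Summit.AtomisticToContinuum.Crystallization.Theorems.ChartedPlanarOrderProfileSlavingLJBalance (StraddleSummable
  nashBalance_of_layerForceBalance)
open Summit.AtomisticToContinuum.Crystallization.Theorems.ChartedPlanarOrderProfileSlavingLJLayerBalance (layerForceBalance_holds)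
open Summit.AtomisticToContinuum.Crystallization.Theorems.OverbindingBudgetPeriodicCleanOrStrained (UniformlyClean)
open Summit.AtomisticToContinuum.Crystallization.Theorems.OverbindingBudgetTightDozen (TightDozenRigidity)
open Summit.AtomisticToContinuum.Crystallization.Theorems.OverbindingBudgetBalancedLayered (BalancedLayeredClean
  rdef_of_grossU_doorPeriodic_balanced)

/-! ## §1 The pieces -/

/-- **`BalancedStackedClean Λ₁`** — slot 7 restricted to STACKED representations (lens-3's `IsStacked`: a common normal `n ⊥ a, b` along
which the coset offsets strictly increase — one coset per height) with in-plane periods of norm `≤ Λ₁` (`Λ₁ = 17/16`: nearest-neighbour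
periods, no superstructure): such a `δ`-separated two-shell-clean single-site-Nash virial-balanced stress-free configuration is uniformly
clean. [⟸ `NashBalance Λ₁ ∧ GapStressVanishes Λ₁ ∧ BasalGapRigidity Λ₁` (§2); UNDECIDED·TRUE-type.] [piece] -/
def BalancedStackedClean (Λ₁ : ℝ) : Prop :=
  ∀ δ : ℝ, 0 < δ → ∀ (a b : EuclideanSpace ℝ (Fin 3)) (w : ℤ → EuclideanSpace ℝ (Fin 3)), IsStacked a b w → LinearIndependent ℝ ![a, b] →
    ‖a‖ ≤ Λ₁ → ‖b‖ ≤ Λ₁ → IsSep δ (Layered a b w) → IsClean (μS (Layered a b w)) → IsNash (μS (Layered a b w)) →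
    VirialBalanced (Layered a b w) → StressFree (Layered a b w) → UniformlyClean (Layered a b w)

/-- **`StackedReduction Λ Λ₁`** — the RIGIDITY-BEARING re-representation: a `δ`-separated two-shell-clean single-site-Nash virial-balanced
stress-free `Layered a b w` with independent periods of norm `≤ Λ` IS (as a set) a stacked `Layered a₁ b₁ w₁` with independent in-plane
periods of norm `≤ Λ₁`.  NOT a geometric statement (the (001)-layered bounded perturbations of fcc are clean, separated and layered but not
stacked along close-packed planes): the analytic hypotheses are load-bearing.  At `Λ = 2` a finite family of 1D banded certificates
(period-plane type × supercell index), each concluding «exactly fcc / hcp». [UNDECIDED·TRUE-type; CERT-family·L.] [piece] -/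
def StackedReduction (Λ Λ₁ : ℝ) : Prop :=
  ∀ δ : ℝ, 0 < δ → ∀ (a b : EuclideanSpace ℝ (Fin 3)) (w : ℤ → EuclideanSpace ℝ (Fin 3)), LinearIndependent ℝ ![a, b] → ‖a‖ ≤ Λ → ‖b‖ ≤ Λ →
    IsSep δ (Layered a b w) → IsClean (μS (Layered a b w)) → IsNash (μS (Layered a b w)) →
    VirialBalanced (Layered a b w) → StressFree (Layered a b w) →
    ∃ (a₁ b₁ : EuclideanSpace ℝ (Fin 3)) (w₁ : ℤ → EuclideanSpace ℝ (Fin 3)), Layered a₁ b₁ w₁ = Layered a b w ∧ IsStacked a₁ b₁ w₁ ∧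
      LinearIndependent ℝ ![a₁, b₁] ∧ ‖a₁‖ ≤ Λ₁ ∧ ‖b₁‖ ≤ Λ₁

/-- **`GapStressVanishes Λ₁`** — the virial identity read against `StressFree`: on a `δ`-separated clean Nash stacked configuration with
in-plane periods of norm `≤ Λ₁`, a CONSTANT transmitted gap stress (lens-3's `gapStress`, the output of `NashBalance`) of a stress-free
configuration is zero (`Σ_pairs f ⊗ r` over a slab `=` `Σ_gaps height · σ`, so `σ = |cell| · (Cauchy stress) · n`, and `StressFree` is the
vanishing of every uniaxial virial, hence of the stress tensor). [ANALYTIC·M; TRUE-type (tail bookkeeping as in `StraddleSummable`).] [piece] -/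
def GapStressVanishes (Λ₁ : ℝ) : Prop :=
  ∀ δ : ℝ, 0 < δ → ∀ (a b : EuclideanSpace ℝ (Fin 3)) (w : ℤ → EuclideanSpace ℝ (Fin 3)), IsStacked a b w → LinearIndependent ℝ ![a, b] →
    ‖a‖ ≤ Λ₁ → ‖b‖ ≤ Λ₁ → IsSep δ (Layered a b w) → IsClean (μS (Layered a b w)) → IsNash (μS (Layered a b w)) →
    StressFree (Layered a b w) → ∀ σ : EuclideanSpace ℝ (Fin 3), (∀ m : ℤ, gapStress a b m (incr w) = σ) → σ = 0

/-- **`BasalGapRigidity Λ₁`** — the CERTIFICATE TARGET of slot 7: on a `δ`-separated two-shell-clean (single-site-Nash, spare) stress-free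
stacked configuration with independent in-plane periods of norm `≤ Λ₁`, vanishing transmitted stress across EVERY gap forces uniform
cleanliness (all twelve contacts of every site within `2 %` of one spacing `a' ∈ [47/50, 1]`, empty gap `(1.02 a', 1.26 a')`).  Mechanism:
the gap equations `σ_gap(m) = 0` (three per gap: registry + height) are a banded system whose own-gap block dominates the couplings to gaps
`m ± k` (pairs spanning `≥ 2` gaps, LJ decay), so their solutions in the `1/16`-clean window are the near-ideal Barlow stackings (hollow
registry, equilibrium height within `10⁻³` of `√(2/3)·s`, `s` pinned by the in-plane components of `StressFree`). [UNDECIDED·TRUE-type;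
CERT (interval arithmetic on 2D lattice sums; census TAG 141 (a): homogeneous stiffness `54.77`/site).] [piece] -/
def BasalGapRigidity (Λ₁ : ℝ) : Prop :=
  ∀ δ : ℝ, 0 < δ → ∀ (a b : EuclideanSpace ℝ (Fin 3)) (w : ℤ → EuclideanSpace ℝ (Fin 3)), IsStacked a b w → LinearIndependent ℝ ![a, b] →
    ‖a‖ ≤ Λ₁ → ‖b‖ ≤ Λ₁ → IsSep δ (Layered a b w) → IsClean (μS (Layered a b w)) → IsNash (μS (Layered a b w)) →
    StressFree (Layered a b w) → (∀ m : ℤ, gapStress a b m (incr w) = 0) → UniformlyClean (Layered a b w)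

/-! ## §2 The seams -/

/-- **Seam, PROVED.** `NashBalance Λ₁ → GapStressVanishes Λ₁ → BasalGapRigidity Λ₁ → BalancedStackedClean Λ₁` (constant gap stress; it
vanishes; the certificate concludes). [this file] -/
theorem balancedStackedClean_of_pieces {Λ₁ : ℝ} (hN : NashBalance Λ₁) (hV : GapStressVanishes Λ₁) (hR : BasalGapRigidity Λ₁) :
    BalancedStackedClean Λ₁ := by
  intro δ hδ a b w hst hab ha hb hsep hcl hna _hvb hsf
  obtain ⟨σ, hσ⟩ := hN δ hδ a b w ha hb hsep hcl hna hst
  have hσ0 : σ = 0 := hV δ hδ a b w hst hab ha hb hsep hcl hna hsf σ hσ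
  exact hR δ hδ a b w hst hab ha hb hsep hcl hna hsf fun m => by rw [hσ m, hσ0]

/-- **Seam with lens-3's D1a BY NAME, PROVED.** `StraddleSummable Λ₁ → GapStressVanishes Λ₁ → BasalGapRigidity Λ₁ → BalancedStackedClean Λ₁`
(`NashBalance Λ₁` from `layerForceBalance_holds Λ₁` and `nashBalance_of_layerForceBalance`). [this file] -/
theorem balancedStackedClean_of_straddle {Λ₁ : ℝ} (hS : StraddleSummable Λ₁) (hV : GapStressVanishes Λ₁) (hR : BasalGapRigidity Λ₁) :
    BalancedStackedClean Λ₁ :=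
  balancedStackedClean_of_pieces (nashBalance_of_layerForceBalance (layerForceBalance_holds Λ₁) hS) hV hR

/-- **Seam, PROVED.** `StackedReduction Λ Λ₁ → BalancedStackedClean Λ₁ → BalancedLayeredClean Λ` (uniform cleanliness is a property of
the set). [this file] -/
theorem balancedLayeredClean_of_stacked {Λ Λ₁ : ℝ} (hSR : StackedReduction Λ Λ₁) (hBS : BalancedStackedClean Λ₁) :
    BalancedLayeredClean Λ := by
  intro δ hδ a b w hab ha hb hsep hcl hna hvb hsf
  obtain ⟨a₁, b₁, w₁, hEq, hst, hab₁, ha₁, hb₁⟩ := hSR δ hδ a b w hab ha hb hsep hcl hna hvb hsf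
  have h := hBS δ hδ a₁ b₁ w₁ hst hab₁ ha₁ hb₁ (hEq ▸ hsep) (hEq ▸ hcl) (hEq ▸ hna) (hEq ▸ hvb) (hEq ▸ hsf)
  rwa [hEq] at h

/-- `StackedReduction Λ Λ₁ → StraddleSummable Λ₁ → GapStressVanishes Λ₁ → BasalGapRigidity Λ₁ → BalancedLayeredClean Λ`. [this file] -/
theorem balancedLayeredClean_of_basal {Λ Λ₁ : ℝ} (hSR : StackedReduction Λ Λ₁) (hS : StraddleSummable Λ₁) (hV : GapStressVanishes Λ₁)
    (hR : BasalGapRigidity Λ₁) : BalancedLayeredClean Λ :=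
  balancedLayeredClean_of_stacked hSR (balancedStackedClean_of_straddle hS hV hR)

/-! ## §3 The cone, twelfth form -/

/-- **RDEF cone, twelfth form** (every `Λ`, `Λ₁`): `GrossCleanBallsU (1/250) 10 → ChargedEnergyGap → CompressedVirialLaw (1/250) 10 →
TightDozenRigidity (1/250) → CleanCharted (1/250) 10 → DoorPeriodic Λ → StackedReduction Λ Λ₁ → StraddleSummable Λ₁ → GapStressVanishes Λ₁ →
BasalGapRigidity Λ₁ → CleanlessExcessT → CoherentResidual 10 → RobustDefectLimitWindows` — the ninth form with slot 7 cut. [this file] -/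
theorem rdef_of_grossU_doorPeriodic_basal (Λ Λ₁ : ℝ) (hG : GrossCleanBallsU (1 / 250) 10) (hCEG : ChargedEnergyGap)
    (hC : CompressedVirialLaw (1 / 250) 10) (hK : TightDozenRigidity (1 / 250)) (h₂ : CleanCharted (1 / 250) 10) (hD : DoorPeriodic Λ)
    (hSR : StackedReduction Λ Λ₁) (hS : StraddleSummable Λ₁) (hV : GapStressVanishes Λ₁) (hR : BasalGapRigidity Λ₁)
    (hCE : CleanlessExcessT) (hRes : CoherentResidual 10) : RobustDefectLimitWindows :=
  rdef_of_grossU_doorPeriodic_balanced Λ hG hCEG hC hK h₂ hD (balancedLayeredClean_of_basal hSR hS hV hR) hCE hRes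

end Summit.AtomisticToContinuum.Crystallization.Theorems.OverbindingBudgetBasalGapRigidity

end
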